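import Mathlib
import Summits.ResolutionOfSingularities.ResolutionOfSingularities.Theorems.WeightedInvariantLocalWeightedDropNCDirectrixCutPairLiftRename
import Summits.ResolutionOfSingularities.ResolutionOfSingularities.Theorems.WeightedInvariantLocalWeightedDropTOT2BridgeCurvePermissible

/-!
# `WeightedInvariant.LocalWeightedDrop`: LINE `directrix-cut`, SNC₂ — THE x₀-LIFT (2/5): THE CHART TRANSFORM AND THE STRICT TRANSFORMS OF THE LIFTED PAIR

OURS (res-L1-w43-stub-4 g6 for the ENGINE crux `LocalWeightedDrop` stmt-ResolutionOfSingularities-8899, W′|₄ line, R₂ corner, piece LIFT of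
res-L1-w43-strat-1's `stub_pairLift` (g11 `snc2_interface_v1.lean` e57a74989d55635b); candidates, not facts; counted 0).  THE x₀-LIFT transports a
`(m+1)`-variable B-permissible decorated strategy (`TameFourTupleDrop.DBWinsTo`, res-L1-w43-lead-1 p575221) along the product structure of a pair
position `Φ^*f = u · X₀ · (X₀ + g(x₁…x_{m+1}))`: lifted moves `(Φ;Λ(Ψ), (1,w))` with `Λ(Ψ) = (X₀, rename succ ∘ Ψ)`; answers with `c₀ ≠ 0` exit by a
head drop, answers with `c₀ = 0` are pair positions over the shadow's transform, normal-crossing shadows are monomial pair positions.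

THIS FILE: `(Λ(Ψ)^*(u·X₀·(X₀+g)))∘chart = s²·U·(c₀+y₀)·((c₀+y₀)+s^{a−1}Γ)` from `(Ψ^*g)∘chart₃ = sᵃΓ`; `s` does not divide the bracket, so it IS
the `s`-free part (`satPart_fChart_lift`); the bracket sliced at the slot `0` and at a slot `j+1`; (a) at `(c₀ : 0)` the strict transform is a unit,
(b1) at `c₀ ≠ 0` its order is `≤ 1`, (b2) at `c₀ = 0` it is a pair again, read through the transposition `s ↔ y₀`.
-/

set_option linter.dupNamespace false

noncomputable section

namespace Summit.ResolutionOfSingularities.ResolutionOfSingularities.Theorems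

namespace TameFourTupleDrop

namespace PairLift

open MvPowerSeries Literature.AlgebraicGeometry.Resolution

variable {k : Type} [Field k]

/-! # PART 3 — the chart transform of the lifted pair -/

section Chart

variable {m : ℕ}

/-- Coefficients of a `succAbove p`-renamed series at exponents involving `X p` vanish. -/
theorem coeff_rename_succAbove_eq_zero {n : ℕ} (p : Fin (n + 1)) (G : MvPowerSeries (Fin n) k) {d : Fin (n + 1) →₀ ℕ} (hd : d p ≠ 0) :
    coeff d (rename (Fin.succAboveEmb p) G) = 0 := by
  refine coeff_rename_eq_zero _ _ ?_
  rintro ⟨x, rfl⟩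
  exact hd (Finsupp.mapDomain_notin_range _ _ fun ⟨i, hi⟩ => Fin.succAbove_ne p i hi)

/-- **THE CHART TRANSFORM OF THE LIFTED PAIR.**  If `(Ψ^*g)∘chart_{w,c} = sᵃ · Γ` with `a ≥ 1`, then
`(Λ(Ψ)^*(u · X₀ · (X₀ + g)))∘chart_{(1,w),(c₀,c)} = s² · U · (c₀ + y₀) · ((c₀ + y₀) + s^{a−1} · Γ)` (`Γ` read in the four-variable chart). -/
theorem chart_liftFam_pair {Ψ : Fin (m + 1) → MvPowerSeries (Fin (m + 1)) k} (hΨ0 : ∀ j, constantCoeff (Ψ j) = 0)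
    {w : Fin (m + 1) → ℕ} {c : Fin (m + 1) → k} (hc : ∀ j, w j = 0 → c j = 0) (c₀ : k) (u : MvPowerSeries (Fin (m + 1 + 1)) k)
    {g : MvPowerSeries (Fin (m + 1)) k} {a : ℕ} {Γ : MvPowerSeries (Fin (m + 1 + 1)) k} (ha : 1 ≤ a)
    (hfac : subst (CobordantChart.chart w c) (subst Ψ g) = X 0 ^ a * Γ) :
    subst (CobordantChart.chart (Fin.cons 1 w : Fin (m + 1 + 1) → ℕ) (Fin.cons c₀ c : Fin (m + 1 + 1) → k))
        (subst ((Fin.cons (X 0) (fun j => rename (Fin.succEmb (m + 1)) (Ψ j)) : Fin (m + 1 + 1) → MvPowerSeries (Fin (m + 1 + 1)) k))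
          (u * (X 0 * (X 0 + rename (Fin.succEmb (m + 1)) g)))) =
      X 0 ^ 2 * (subst (CobordantChart.chart (Fin.cons 1 w : Fin (m + 1 + 1) → ℕ) (Fin.cons c₀ c : Fin (m + 1 + 1) → k))
          (subst ((Fin.cons (X 0) (fun j => rename (Fin.succEmb (m + 1)) (Ψ j)) : Fin (m + 1 + 1) → MvPowerSeries (Fin (m + 1 + 1)) k)) u) *
        ((C c₀ + X 1) * ((C c₀ + X 1) + X 0 ^ (a - 1) * rename (Fin.succAboveEmb (1 : Fin (m + 1 + 1 + 1))) Γ))) := by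
  have hch := CobordantChart.hasSubst_chart (Fin.cons 1 w : Fin (m + 1 + 1) → ℕ) (Fin.cons c₀ c : Fin (m + 1 + 1) → k) (chartConv_cons hc c₀)
  rw [subst_liftFam_pair hΨ0 u g, ← coe_substAlgHom hch]
  simp only [map_mul, map_add, coe_substAlgHom, subst_X hch]
  rw [chart_cons_zero, subst_chart_rename_succ hc c₀, hfac, map_mul, map_pow, rename_X, Fin.succAboveEmb_apply,
    Fin.succAbove_ne_zero_zero one_ne_zero]
  have hX : (X 0 : MvPowerSeries (Fin (m + 1 + 1 + 1)) k) ^ a = X 0 * X 0 ^ (a - 1) := by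
    rw [← pow_succ', Nat.sub_add_cancel ha]
  rw [hX]
  ring

/-- The `y₀`-coefficient of the correction term `s^{a−1} · Γ` vanishes (`Γ` has no `y₀`; for `a ≥ 2` the term is a multiple of `s`). -/
theorem coeff_single_one_correction {n : ℕ} (a : ℕ) (Γ : MvPowerSeries (Fin (n + 1)) k) :
    coeff (Finsupp.single (1 : Fin (n + 1 + 1)) 1) (X 0 ^ (a - 1) * rename (Fin.succAboveEmb (1 : Fin (n + 1 + 1))) Γ) = 0 := by
  by_cases ha : a - 1 = 0
  · rw [ha, pow_zero, one_mul]
    exact coeff_rename_succAbove_eq_zero 1 Γ (by rw [Finsupp.single_eq_same]; exact one_ne_zero)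
  · have hdvd : (X 0 : MvPowerSeries (Fin (n + 1 + 1)) k) ∣ X 0 ^ (a - 1) * rename (Fin.succAboveEmb (1 : Fin (n + 1 + 1))) Γ :=
      dvd_mul_of_dvd_left (dvd_pow_self _ ha) _
    exact X_dvd_iff.mp hdvd _ (by rw [Finsupp.single_apply, if_neg one_ne_zero])

/-- The `y₀`-coefficient of `c₀ + y₀` is `1`. -/
theorem coeff_single_one_lin {n : ℕ} (c₀ : k) :
    coeff (Finsupp.single (1 : Fin (n + 1 + 1)) 1) (C c₀ + X 1 : MvPowerSeries (Fin (n + 1 + 1)) k) = 1 := by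
  rw [map_add, coeff_C, if_neg (Finsupp.single_ne_zero.mpr one_ne_zero), coeff_X, if_pos rfl, zero_add]

/-- The `y₀`-coefficient of the second factor `(c₀ + y₀) + s^{a−1} Γ` is `1`. -/
theorem coeff_single_one_factor {n : ℕ} (c₀ : k) (a : ℕ) (Γ : MvPowerSeries (Fin (n + 1)) k) :
    coeff (Finsupp.single (1 : Fin (n + 1 + 1)) 1)
      (C c₀ + X 1 + X 0 ^ (a - 1) * rename (Fin.succAboveEmb (1 : Fin (n + 1 + 1))) Γ : MvPowerSeries (Fin (n + 1 + 1)) k) = 1 := by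
  rw [map_add, coeff_single_one_lin, coeff_single_one_correction, add_zero]

/-- **THE EXCEPTIONAL LETTER DOES NOT DIVIDE THE BRACKET** `U · (c₀ + y₀) · ((c₀ + y₀) + s^{a−1} Γ)` (`U` a unit): read the `y₀`-coefficients. -/
theorem not_X_zero_dvd_bracket {n : ℕ} {U : MvPowerSeries (Fin (n + 1 + 1)) k} (hU : constantCoeff U ≠ 0) (c₀ : k) (a : ℕ)
    (Γ : MvPowerSeries (Fin (n + 1)) k) :
    ¬ (X 0 : MvPowerSeries (Fin (n + 1 + 1)) k) ∣
      U * ((C c₀ + X 1) * ((C c₀ + X 1) + X 0 ^ (a - 1) * rename (Fin.succAboveEmb (1 : Fin (n + 1 + 1))) Γ)) := by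
  have hp := MvPowerSeries.prime_X' k (0 : Fin (n + 1 + 1))
  have h10 : (Finsupp.single (1 : Fin (n + 1 + 1)) 1 : Fin (n + 1 + 1) →₀ ℕ) 0 = 0 := by
    rw [Finsupp.single_apply, if_neg one_ne_zero]
  intro h
  rcases hp.dvd_or_dvd h with hU' | hLV
  · obtain ⟨t, ht⟩ := hU'
    rw [ht, map_mul, constantCoeff_X, zero_mul] at hU
    exact hU rfl
  · rcases hp.dvd_or_dvd hLV with hL | hV
    · have h0 := X_dvd_iff.mp hL _ h10
      rw [coeff_single_one_lin] at h0
      exact one_ne_zero h0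
    · have h0 := X_dvd_iff.mp hV _ h10
      rw [coeff_single_one_factor] at h0
      exact one_ne_zero h0

/-- The chart of the lifted move is constant-free, so constant coefficients pass through it. -/
theorem constantCoeff_subst_chart_cons {w : Fin (m + 1) → ℕ} {c : Fin (m + 1) → k} (hc : ∀ j, w j = 0 → c j = 0) (c₀ : k)
    (F : MvPowerSeries (Fin (m + 1 + 1)) k) :
    constantCoeff (subst (CobordantChart.chart (Fin.cons 1 w : Fin (m + 1 + 1) → ℕ) (Fin.cons c₀ c : Fin (m + 1 + 1) → k)) F) =
      constantCoeff F := by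
  refine TOT2E1.constantCoeff_subst_of_constantCoeff_zero _ (fun l => ?_) F
  rw [CobordantChart.chart_apply]
  by_cases hw : (Fin.cons 1 w : Fin (m + 1 + 1) → ℕ) l = 0
  · rw [hw, pow_zero, one_mul, chartConv_cons hc c₀ l hw, map_zero, zero_add, constantCoeff_X]
  · rw [map_mul, map_pow, constantCoeff_X, zero_pow hw, zero_mul]

/-- **THE `s`-SATURATION OF THE LIFTED PAIR** (any decoration whose equation reads `u · X₀ · (X₀ + g)` through `Φ`): at the point `(c₀, c)` of the
move `(Φ ; Λ(Ψ), (1, w))` the `s`-free part of the chart transform is the bracket and the exponent is `2`. -/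
theorem satPart_fChart_lift {δ : Decoration k (m + 1)} {Φ : Fin (m + 1 + 1) → MvPowerSeries (Fin (m + 1 + 1)) k}
    (hΦ0 : ∀ l, constantCoeff (Φ l) = 0) (hΦdet : IsUnit (Matrix.det (Matrix.of fun i j => coeff (Finsupp.single j 1) (Φ i))))
    {u : MvPowerSeries (Fin (m + 1 + 1)) k} {g : MvPowerSeries (Fin (m + 1)) k} (hu : constantCoeff u ≠ 0)
    (hf : subst Φ δ.f = u * (X 0 * (X 0 + rename (Fin.succEmb (m + 1)) g))) (hf0 : δ.f ≠ 0)
    {Ψ : Fin (m + 1) → MvPowerSeries (Fin (m + 1)) k} (hΨ0 : ∀ j, constantCoeff (Ψ j) = 0)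
    (hΨdet : IsUnit (Matrix.det (Matrix.of fun i j => coeff (Finsupp.single j 1) (Ψ i)))) {w : Fin (m + 1) → ℕ} (hw : ∀ j, w j ≤ 1)
    {c : Fin (m + 1) → k} (hc : ∀ j, w j = 0 → c j = 0) (c₀ : k) {a : ℕ} {Γ : MvPowerSeries (Fin (m + 1 + 1)) k} (ha : 1 ≤ a)
    (hfac : subst (CobordantChart.chart w c) (subst Ψ g) = X 0 ^ a * Γ) :
    satPart (δ.fChart (fun l => subst ((Fin.cons (X 0) (fun j => rename (Fin.succEmb (m + 1)) (Ψ j)) :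
        Fin (m + 1 + 1) → MvPowerSeries (Fin (m + 1 + 1)) k)) (Φ l)) (Fin.cons 1 w : Fin (m + 1 + 1) → ℕ) (Fin.cons c₀ c : Fin (m + 1 + 1) → k)) =
      subst (CobordantChart.chart (Fin.cons 1 w : Fin (m + 1 + 1) → ℕ) (Fin.cons c₀ c : Fin (m + 1 + 1) → k))
          (subst ((Fin.cons (X 0) (fun j => rename (Fin.succEmb (m + 1)) (Ψ j)) : Fin (m + 1 + 1) → MvPowerSeries (Fin (m + 1 + 1)) k)) u) *
        ((C c₀ + X 1) * ((C c₀ + X 1) + X 0 ^ (a - 1) * rename (Fin.succAboveEmb (1 : Fin (m + 1 + 1 + 1))) Γ)) := by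
  have hmv := isCountMove_liftMove hΦ0 hΦdet hΨ0 hΨdet hw
  have hconv := chartConv_cons hc c₀
  obtain ⟨hfacT, hndvd⟩ := Decoration.fChart_eq (δ := δ) (c := (Fin.cons c₀ c : Fin (m + 1 + 1) → k)) hmv hconv hf0
  have hcomp : subst (fun l => subst ((Fin.cons (X 0) (fun j => rename (Fin.succEmb (m + 1)) (Ψ j)) :
      Fin (m + 1 + 1) → MvPowerSeries (Fin (m + 1 + 1)) k)) (Φ l)) δ.f =
      subst ((Fin.cons (X 0) (fun j => rename (Fin.succEmb (m + 1)) (Ψ j)) : Fin (m + 1 + 1) → MvPowerSeries (Fin (m + 1 + 1)) k))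
        (u * (X 0 * (X 0 + rename (Fin.succEmb (m + 1)) g))) := by
    rw [← hf, subst_comp_subst_apply (hasSubst_of_constantCoeff_zero hΦ0) (hasSubst_liftFam hΨ0)]
  rw [hcomp, chart_liftFam_pair hΨ0 hc c₀ u ha hfac] at hfacT
  have hU : constantCoeff (subst (CobordantChart.chart (Fin.cons 1 w : Fin (m + 1 + 1) → ℕ) (Fin.cons c₀ c : Fin (m + 1 + 1) → k))
      (subst ((Fin.cons (X 0) (fun j => rename (Fin.succEmb (m + 1)) (Ψ j)) : Fin (m + 1 + 1) → MvPowerSeries (Fin (m + 1 + 1)) k)) u)) ≠ 0 := by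
    rw [constantCoeff_subst_chart_cons hc, TOT2E1.constantCoeff_subst_of_constantCoeff_zero _ (constantCoeff_liftFam hΨ0)]
    exact hu
  exact (eq_of_X_zero_pow_mul_eq hfacT (not_X_zero_dvd_bracket hU c₀ a Γ) hndvd).2.symm

end Chart

/-! # PART 4 — the strict transforms of the lifted pair at the three kinds of answers -/

section Strict

variable {m : ℕ}

/-- The slice family is constant-free. -/
theorem constantCoeff_sliceFam {n : ℕ} (i : Fin (n + 1)) (j : Fin (n + 1 + 1)) :
    constantCoeff ((fun j : Fin (n + 1 + 1) => if j = i.succ then (0 : MvPowerSeries (Fin (n + 1)) k) else X (Fin.predAbove i j)) j) = 0 := by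
  dsimp only
  split_ifs
  · exact map_zero _
  · exact constantCoeff_X _

/-- Slicing preserves constant coefficients. -/
theorem constantCoeff_slice {n : ℕ} (i : Fin (n + 1)) (G : MvPowerSeries (Fin (n + 1 + 1)) k) :
    constantCoeff (TupleGame.slice i G) = constantCoeff G :=
  TOT2E1.constantCoeff_subst_of_constantCoeff_zero _ (constantCoeff_sliceFam i) G

/-- **THE BRACKET SLICED AT THE SLOT `0`** (`y₀ := 0`): `U₀ · c₀ · (c₀ + s^{a−1} E₀)`. -/
theorem slice_zero_bracket (U : MvPowerSeries (Fin (m + 1 + 1 + 1)) k) (c₀ : k) (a : ℕ) (E : MvPowerSeries (Fin (m + 1 + 1 + 1)) k) :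
    TupleGame.slice 0 (U * ((C c₀ + X 1) * ((C c₀ + X 1) + X 0 ^ (a - 1) * E))) =
      TupleGame.slice 0 U * (C c₀ * (C c₀ + X 0 ^ (a - 1) * TupleGame.slice 0 E)) := by
  unfold TupleGame.slice
  set σ : Fin (m + 1 + 1 + 1) → MvPowerSeries (Fin (m + 1 + 1)) k :=
    fun j => if j = (0 : Fin (m + 1 + 1)).succ then (0 : MvPowerSeries (Fin (m + 1 + 1)) k) else X (Fin.predAbove 0 j) with hσdef
  have hσ : HasSubst σ := CobordantChartPlaneSlice.hasSubst_slice (R := k) 0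
  have h1 : σ 1 = 0 := by rw [hσdef]; dsimp only; rw [if_pos Fin.succ_zero_eq_one.symm]
  have h0 : σ 0 = X 0 := by rw [hσdef]; dsimp only; rw [if_neg (Fin.succ_ne_zero _).symm, Fin.predAbove_right_zero]
  rw [← coe_substAlgHom hσ]
  simp only [map_mul, map_add, map_pow, coe_substAlgHom, subst_X hσ, MvPowerSeries.subst_C, h1, h0, add_zero]

/-- `predAbove (succ j) 1 = 1`. -/
theorem predAbove_succ_one' {n : ℕ} (j : Fin (n + 1)) : Fin.predAbove (j.succ : Fin (n + 1 + 1)) (1 : Fin (n + 1 + 1 + 1)) = 1 := by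
  have h : (1 : Fin (n + 1 + 1 + 1)) ≤ Fin.castSucc j.succ := by
    rw [Fin.le_def, Fin.val_one, Fin.val_castSucc, Fin.val_succ]; omega
  rw [Fin.predAbove_of_le_castSucc _ _ h, Fin.castPred_one]

/-- **THE BRACKET SLICED AT A SLOT `j + 1`**: `U' · (c₀ + y₀) · ((c₀ + y₀) + s^{a−1} Γ|_{slice j})`. -/
theorem slice_succ_bracket (U : MvPowerSeries (Fin (m + 1 + 1 + 1)) k) (c₀ : k) (a : ℕ) (Γ : MvPowerSeries (Fin (m + 1 + 1)) k)
    (j : Fin (m + 1)) :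
    TupleGame.slice j.succ (U * ((C c₀ + X 1) * ((C c₀ + X 1) + X 0 ^ (a - 1) * rename (Fin.succAboveEmb (1 : Fin (m + 1 + 1 + 1))) Γ))) =
      TupleGame.slice j.succ U * ((C c₀ + X 1) * ((C c₀ + X 1) + X 0 ^ (a - 1) *
        rename (Fin.succAboveEmb (1 : Fin (m + 1 + 1))) (TupleGame.slice j Γ))) := by
  rw [← slice_succ_rename j Γ]
  unfold TupleGame.slice
  set σ : Fin (m + 1 + 1 + 1) → MvPowerSeries (Fin (m + 1 + 1)) k :=
    fun l => if l = (j.succ : Fin (m + 1 + 1)).succ then (0 : MvPowerSeries (Fin (m + 1 + 1)) k) else X (Fin.predAbove j.succ l) with hσdef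
  have hσ : HasSubst σ := CobordantChartPlaneSlice.hasSubst_slice (R := k) j.succ
  have h1 : σ 1 = X 1 := by
    rw [hσdef]; dsimp only
    rw [if_neg (fun h => Fin.succ_ne_zero j (Fin.succ_injective _ (h.symm.trans Fin.succ_zero_eq_one.symm))), predAbove_succ_one']
  have h0 : σ 0 = X 0 := by rw [hσdef]; dsimp only; rw [if_neg (Fin.succ_ne_zero _).symm, Fin.predAbove_right_zero]
  rw [← coe_substAlgHom hσ]
  simp only [map_mul, map_add, map_pow, coe_substAlgHom, subst_X hσ, MvPowerSeries.subst_C, h1, h0]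

/-- **(a) AT THE POINT `c = (c₀ : 0 : … : 0)`, SLOT `0`, THE STRICT TRANSFORM IS A UNIT** (when `Γ(0) = 0`): its constant coefficient is `U(0) · c₀²`. -/
theorem constantCoeff_strict_lift_slot_zero {δ : Decoration k (m + 1)} {Φ : Fin (m + 1 + 1) → MvPowerSeries (Fin (m + 1 + 1)) k}
    (hΦ0 : ∀ l, constantCoeff (Φ l) = 0) (hΦdet : IsUnit (Matrix.det (Matrix.of fun i j => coeff (Finsupp.single j 1) (Φ i))))
    {u : MvPowerSeries (Fin (m + 1 + 1)) k} {g : MvPowerSeries (Fin (m + 1)) k} (hu : constantCoeff u ≠ 0)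
    (hf : subst Φ δ.f = u * (X 0 * (X 0 + rename (Fin.succEmb (m + 1)) g))) (hf0 : δ.f ≠ 0)
    {Ψ : Fin (m + 1) → MvPowerSeries (Fin (m + 1)) k} (hΨ0 : ∀ j, constantCoeff (Ψ j) = 0)
    (hΨdet : IsUnit (Matrix.det (Matrix.of fun i j => coeff (Finsupp.single j 1) (Ψ i)))) {w : Fin (m + 1) → ℕ} (hw : ∀ j, w j ≤ 1)
    {c₀ : k} (hc₀ : c₀ ≠ 0) {a : ℕ} {Γ : MvPowerSeries (Fin (m + 1 + 1)) k} (ha : 1 ≤ a)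
    (hfac : subst (CobordantChart.chart w (fun _ => (0 : k))) (subst Ψ g) = X 0 ^ a * Γ) (hΓ0 : constantCoeff Γ = 0) :
    constantCoeff (δ.strict (fun l => subst ((Fin.cons (X 0) (fun j => rename (Fin.succEmb (m + 1)) (Ψ j)) :
        Fin (m + 1 + 1) → MvPowerSeries (Fin (m + 1 + 1)) k)) (Φ l)) (Fin.cons 1 w : Fin (m + 1 + 1) → ℕ)
        (Fin.cons c₀ (fun _ => (0 : k)) : Fin (m + 1 + 1) → k) 0) ≠ 0 := by
  unfold Decoration.strict
  rw [satPart_fChart_lift hΦ0 hΦdet hu hf hf0 hΨ0 hΨdet hw (fun _ _ => rfl) c₀ ha hfac, slice_zero_bracket, map_mul, constantCoeff_slice,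
    constantCoeff_subst_chart_cons (fun _ _ => rfl), TOT2E1.constantCoeff_subst_of_constantCoeff_zero _ (constantCoeff_liftFam hΨ0), map_mul,
    map_add, constantCoeff_C, map_mul, constantCoeff_slice, constantCoeff_rename', hΓ0, mul_zero, add_zero]
  exact mul_ne_zero hu (mul_ne_zero hc₀ hc₀)

/-- **(b1) AT A POINT WITH `c₀ ≠ 0`, SLOT `j + 1`, THE ORDER DROPS TO `≤ 1`**: the strict transform is `unit · unit · V` with `V` linear in `y₀`. -/
theorem o_transform_lift_slot_succ_le_one {δ : Decoration k (m + 1)} {Φ : Fin (m + 1 + 1) → MvPowerSeries (Fin (m + 1 + 1)) k}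
    (hΦ0 : ∀ l, constantCoeff (Φ l) = 0) (hΦdet : IsUnit (Matrix.det (Matrix.of fun i j => coeff (Finsupp.single j 1) (Φ i))))
    {u : MvPowerSeries (Fin (m + 1 + 1)) k} {g : MvPowerSeries (Fin (m + 1)) k} (hu : constantCoeff u ≠ 0)
    (hf : subst Φ δ.f = u * (X 0 * (X 0 + rename (Fin.succEmb (m + 1)) g))) (hf0 : δ.f ≠ 0)
    {Ψ : Fin (m + 1) → MvPowerSeries (Fin (m + 1)) k} (hΨ0 : ∀ j, constantCoeff (Ψ j) = 0)
    (hΨdet : IsUnit (Matrix.det (Matrix.of fun i j => coeff (Finsupp.single j 1) (Ψ i)))) {w : Fin (m + 1) → ℕ} (hw : ∀ j, w j ≤ 1)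
    {c : Fin (m + 1) → k} (hc : ∀ j, w j = 0 → c j = 0) {c₀ : k} (hc₀ : c₀ ≠ 0) {a : ℕ} {Γ : MvPowerSeries (Fin (m + 1 + 1)) k} (ha : 1 ≤ a)
    (hfac : subst (CobordantChart.chart w c) (subst Ψ g) = X 0 ^ a * Γ) (j : Fin (m + 1)) :
    (δ.transform (fun l => subst ((Fin.cons (X 0) (fun j => rename (Fin.succEmb (m + 1)) (Ψ j)) :
        Fin (m + 1 + 1) → MvPowerSeries (Fin (m + 1 + 1)) k)) (Φ l)) (Fin.cons 1 w : Fin (m + 1 + 1) → ℕ)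
        (Fin.cons c₀ c : Fin (m + 1 + 1) → k) j.succ).o ≤ 1 := by
  rw [Decoration.transform_o]
  refine ENat.toNat_le_of_le_coe ((order_sqfRep_le _).trans ?_)
  unfold Decoration.strict
  rw [satPart_fChart_lift hΦ0 hΦdet hu hf hf0 hΨ0 hΨdet hw hc c₀ ha hfac, slice_succ_bracket, order_mul, order_mul,
    order_eq_zero_of_constantCoeff_ne_zero (by
      rw [constantCoeff_slice, constantCoeff_subst_chart_cons hc, TOT2E1.constantCoeff_subst_of_constantCoeff_zero _ (constantCoeff_liftFam hΨ0)]
      exact hu),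
    order_eq_zero_of_constantCoeff_ne_zero (by rw [map_add, constantCoeff_C, constantCoeff_X, add_zero]; exact hc₀), zero_add, zero_add]
  refine (order_le (d := Finsupp.single 1 1) ?_).trans (le_of_eq (by rw [Finsupp.degree_single]))
  rw [coeff_single_one_factor]
  exact one_ne_zero

/-- **(b2) AT A POINT WITH `c₀ = 0`, SLOT `j + 1`, THE STRICT TRANSFORM IS A PAIR AGAIN**: `U' · y₀ · (y₀ + s^{a−1} Γ|_{slice j})`. -/
theorem strict_lift_slot_succ {δ : Decoration k (m + 1)} {Φ : Fin (m + 1 + 1) → MvPowerSeries (Fin (m + 1 + 1)) k}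
    (hΦ0 : ∀ l, constantCoeff (Φ l) = 0) (hΦdet : IsUnit (Matrix.det (Matrix.of fun i j => coeff (Finsupp.single j 1) (Φ i))))
    {u : MvPowerSeries (Fin (m + 1 + 1)) k} {g : MvPowerSeries (Fin (m + 1)) k} (hu : constantCoeff u ≠ 0)
    (hf : subst Φ δ.f = u * (X 0 * (X 0 + rename (Fin.succEmb (m + 1)) g))) (hf0 : δ.f ≠ 0)
    {Ψ : Fin (m + 1) → MvPowerSeries (Fin (m + 1)) k} (hΨ0 : ∀ j, constantCoeff (Ψ j) = 0)
    (hΨdet : IsUnit (Matrix.det (Matrix.of fun i j => coeff (Finsupp.single j 1) (Ψ i)))) {w : Fin (m + 1) → ℕ} (hw : ∀ j, w j ≤ 1)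
    {c : Fin (m + 1) → k} (hc : ∀ j, w j = 0 → c j = 0) {a : ℕ} {Γ : MvPowerSeries (Fin (m + 1 + 1)) k} (ha : 1 ≤ a)
    (hfac : subst (CobordantChart.chart w c) (subst Ψ g) = X 0 ^ a * Γ) (j : Fin (m + 1)) :
    δ.strict (fun l => subst ((Fin.cons (X 0) (fun j => rename (Fin.succEmb (m + 1)) (Ψ j)) :
        Fin (m + 1 + 1) → MvPowerSeries (Fin (m + 1 + 1)) k)) (Φ l)) (Fin.cons 1 w : Fin (m + 1 + 1) → ℕ)
        (Fin.cons 0 c : Fin (m + 1 + 1) → k) j.succ =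
      TupleGame.slice j.succ (subst (CobordantChart.chart (Fin.cons 1 w : Fin (m + 1 + 1) → ℕ) (Fin.cons 0 c : Fin (m + 1 + 1) → k))
          (subst ((Fin.cons (X 0) (fun j => rename (Fin.succEmb (m + 1)) (Ψ j)) : Fin (m + 1 + 1) → MvPowerSeries (Fin (m + 1 + 1)) k)) u)) *
        (X 1 * (X 1 + X 0 ^ (a - 1) * rename (Fin.succAboveEmb (1 : Fin (m + 1 + 1))) (TupleGame.slice j Γ))) := by
  unfold Decoration.strict
  rw [satPart_fChart_lift hΦ0 hΦdet hu hf hf0 hΨ0 hΨdet hw hc 0 ha hfac, slice_succ_bracket, map_zero, zero_add]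

/-- The transposition `s ↔ y₀` after the embedding that skips `y₀` is the embedding that skips `s`. -/
theorem swap_comp_succAbove_one (n : ℕ) :
    (⇑(Equiv.swap (0 : Fin (n + 1 + 1)) 1) ∘ ⇑(Fin.succAboveEmb (1 : Fin (n + 1 + 1))) : Fin (n + 1) → Fin (n + 1 + 1)) = ⇑(Fin.succEmb (n + 1)) := by
  funext t
  rw [Function.comp_apply, Fin.succAboveEmb_apply, Fin.coe_succEmb]
  refine Fin.cases ?_ (fun s => ?_) t
  · rw [Fin.succAbove_ne_zero_zero one_ne_zero, Equiv.swap_apply_left, Fin.succ_zero_eq_one]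
  · rw [Fin.one_succAbove_succ, Equiv.swap_apply_of_ne_of_ne (Fin.succ_ne_zero _)
      (fun h => Fin.succ_ne_zero s (Fin.succ_injective _ (h.trans Fin.succ_zero_eq_one.symm)))]

/-- **(b2) READ THROUGH THE TRANSPOSITION `s ↔ y₀`** the new equation is a pair `U'' · X₀ · (X₀ + rename succ (s^{a−1} · Γ|_{slice j}))`. -/
theorem rename_swap_pair {n : ℕ} (U' : MvPowerSeries (Fin (n + 1 + 1)) k) (a : ℕ) (G : MvPowerSeries (Fin (n + 1)) k) :
    rename (Equiv.swap (0 : Fin (n + 1 + 1)) 1) (U' * (X 1 * (X 1 + X 0 ^ (a - 1) * rename (Fin.succAboveEmb (1 : Fin (n + 1 + 1))) G))) =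
      rename (Equiv.swap (0 : Fin (n + 1 + 1)) 1) U' * (X 0 * (X 0 + rename (Fin.succEmb (n + 1)) (X 0 ^ (a - 1) * G))) := by
  have hG : rename (Equiv.swap (0 : Fin (n + 1 + 1)) 1) (rename (Fin.succAboveEmb (1 : Fin (n + 1 + 1))) G) = rename (Fin.succEmb (n + 1)) G := by
    simp only [rename_rename, swap_comp_succAbove_one]
  have h01 : (Fin.succEmb (n + 1) : Fin (n + 1) → Fin (n + 1 + 1)) 0 = 1 := Fin.succ_zero_eq_one
  rw [map_mul, map_mul, map_add, map_mul, map_pow, rename_X, rename_X, Equiv.swap_apply_right, Equiv.swap_apply_left, hG, map_mul, map_pow,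
    rename_X, h01]

end Strict

end PairLift

end TameFourTupleDrop

end Summit.ResolutionOfSingularities.ResolutionOfSingularities.Theorems

end
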